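import Summits.BirchSwinnertonDyer.BirchSwinnertonDyer.Theorems.DerivedKatoValuationDoorFineLengthLeOneOfAnalyticRankTwoOutputZeta
import Summits.BirchSwinnertonDyer.Rank1Residual.Additive.KatoDescentLocPKummerLogOfClass
import HarnessLib

/-!
# Route `DerivedKatoValuationDoor`, crux `FineLengthLeOneOfAnalyticRankTwo` (stmt-BirchSwinnertonDyer-23259, X′):
# kernels of the LEAD's OUTPUT-line attempt, part 2 — the COLEMAN mechanism over the route decls and the
# position of its open stub N2|door

LEAD prover `bsd-line-dkd-p1` (g2), director-bsd S0 RULING «descent» duty (4); work file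
`Cruxes/FineLengthLeOneOfAnalyticRankTwo/Lines/output.lean` r1. THEOREMS ONLY (no `def`, no new named fact,
no `sorry`); `--supports stmt-BirchSwinnertonDyer-23259`; continues part 1 (`…OutputZeta.lean`). Open
hypotheses DISPLAYED (credit nothing): the asides `CrisAtDoorPrimes` (23148, rider ε), `ColemanStepPosAt`
(23147, rider W₁), `ZetaDepthPosAt` (23146, rider V₁), `ColemanStepDoor` (23145, C₂'), the items 23260, 23029,
the named facts `Kato2004.exists_colemanMap_admissibleZeta` (Kato Thm. 16.4 (ii)/16.6 (2)/Prop. 17.11 = Rubin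
1998 Prop. A.2), `Kato2004.thm12_4`, and the OPEN statement N2|door «`a = 2 ⇒ ord_T L_p(f, α_p) ≤ 2` at door
primes for every newform» (the `a = 2` door slice of `OrdCapAt 2` / `PAdicOrderComparisonR2`; line `birth`'s
`stub_ordLeTwoOfAnalyticRankTwo` of the parent), spelled out verbatim.

WHAT IS PROVED.
* §2 `colemanStepPosAt_of_crisAtDoorPrimes_of_colemanMap` (rider W₁ ⟸ rider ε modulo the Coleman-map fact:
  value law (C3) + the Kurihara–Pollack line for INTEGRAL classes, tree theorem
  `LocPKummer.hasLocPKummerLog_of_exists_log_ne_zero_of_mem_integralH1`),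
  `noAdmissibleClassInTSq_of_ordCapTwoAtDoor_of_colemanStepPosAt` / `derivedKatoDoor_of_ordCapTwoAtDoor_of_colemanStepPosAt`
  (N2|door ∧ W₁ ⟹ Z₂ / D-K₂; the tenure-g2 sketch kernel over the FILED decls),
  `fineLengthLeOne_of_ordCapTwoAtDoor_of_crisAtDoorPrimes_of_facts` (the output composition with every input
  displayed: X′ ⟸ N2|door ∧ ε ∧ 23029 ∧ {Coleman fact, thm12_4, 23260}).
* §3 POSITION: `ordCapTwoAtDoor_of_derivedKatoDoor_of_colemanStepDoor` (Z₂ ∧ C₂' ∧ E ⟹ N2|door) and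
  `colemanStepDoor_of_ordCapTwoAtDoor_of_zetaDepthPosAt` (N2|door ∧ V₁ ⟹ C₂'): N2|door ≡ Z₂ ∧ C₂' modulo the
  riders {23029, 23146, 23147} — the Coleman output stub is the EXISTING node N2 and exceeds the crux by
  exactly the Coleman-step door (aside 23145). («Coleman / explicit reciprocity / E-S0-1 column B»: `v =
  ρ_p − w`, so an Euler-system-side cap on `v` is a cap on the ANALYTIC order `ρ_p`.)
CONSEQUENCE (LEAD report 2026-08-28T22:16Z): no OUTPUT line for X′. BSD is not proved by any of this.

References: [Kato04] = [cite: Kato2004Asterisque, Thm. 12.5 (1),(4) (pp. 221–222), Thm. 16.4 (ii) (p. 270), Thm. 16.6 (p. 271), Prop. 17.11 (p. 277)];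
[Ru98] = [cite: Rubin1998Durham, Appendix Prop. A.2]; [BKS19] = [cite: BurnsKuriharaSano2019, Lemma 6.12–6.14];
[KP07] = [cite: KuriharaPollack2007, Lemma 1.4]; [MTT86] = [cite: MazurTateTeitelbaum1986Invent, §II.10].
-/

-- D-0017: single-problem summit, so `Summit.BirchSwinnertonDyer.BirchSwinnertonDyer.…` repeats a
-- namespace BY DESIGN.
set_option linter.dupNamespace false

noncomputable section

namespace Summit.BirchSwinnertonDyer.BirchSwinnertonDyer.Theorems.DerivedKatoValuationDoor

open Field
open Literature Literature.NumberTheory.GaloisRepresentations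
open Literature.NumberTheory.EllipticCurves Literature.NumberTheory.EllipticCurves.IwasawaAlgebra
open Literature.NumberTheory.EllipticCurves.ModularForms
open Literature.NumberTheory.EllipticCurves.Kato2004
open Literature.NumberTheory.EllipticCurves.Kato2004.EulerSystemValues
open Summit.BirchSwinnertonDyer.BirchSwinnertonDyer.Theses.DerivedKatoValuationDoor
open Summit.BirchSwinnertonDyer.BirchSwinnertonDyer.Theorems

/-! ## §2 The COLEMAN mechanism over the route decls -/

/-- **Rider W₁ from rider ε through the Coleman map: `CrisAtDoorPrimes ⇒ ColemanStepPosAt`** (aside items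
23148 ⇒ 23147), modulo the named fact `exists_colemanMap_admissibleZeta` (Kato Thm. 16.4 (ii)/16.6 (2)/Prop.
17.11 = Rubin 1998 Prop. A.2 read at `𝟙`). If `p^m z₀ = T^k h` then `ord_T L(z₀) = k + ord_T L(h)` for
`L = Col ∘ loc_p` (the domain `ℤ_p⟦T⟧`); the bottom layer `h(𝟙)` is an INTEGRAL class (`proj_mem`,
`layerZeroToTop_mem_integralH1`), hence Kummer at `p` once one integral class has non-zero logarithm there
(the Kurihara–Pollack line for integral classes, tree theorem
`LocPKummer.hasLocPKummerLog_of_exists_log_ne_zero_of_mem_integralH1`), so `L(h)(𝟙) = 0` (value law (C3))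
and `ord_T L(h) ≥ 1`; with `ord_T L(z₀) = ρ_p` (C2): `k + 1 ≤ ρ_p`. CONDITIONAL on the named fact.
[cite: Kato2004Asterisque, Thm. 16.4 (ii) (p. 270), Thm. 16.6 (p. 271), Prop. 17.11 (p. 277)]
[cite: KuriharaPollack2007, §1.4 Lemma 1.4] [cite: BurnsKuriharaSano2019, Lemma 6.12–6.14] -/
theorem colemanStepPosAt_of_crisAtDoorPrimes_of_colemanMap (hC : exists_colemanMap_admissibleZeta)
    (hε : CrisAtDoorPrimes) : ColemanStepPosAt := by
  intro W _ _ p _ _ ha hdoor K hK γ I z₀ hγ hz N _ f hf k hdiv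
  obtain ⟨h, m, hhm⟩ := hdiv
  obtain ⟨h5, hord, hsurj⟩ := hdoor
  obtain ⟨L, hLord, hLval⟩ := hC W p h5 hord hsurj f hf K hK γ hγ I
  -- apply `L` to `p^m • z₀ = T^k • h`
  have hrel : ((p : IwasawaAlgebra p) ^ m) * L z₀ = (PowerSeries.X : IwasawaAlgebra p) ^ k * L h := by
    have e := congrArg L hhm
    simpa only [map_smul, smul_eq_mul] using e
  have hordeq : (L z₀).order = k + (L h).order := by
    have e := congrArg PowerSeries.order hrel
    rwa [PowerSeries.order_mul, PowerSeries.order_mul, order_natCast_prime_pow, zero_add,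
      PowerSeries.order_X_pow] at e
  -- the bottom layer of `h` is integral, hence Kummer at `p` (ε + the Kurihara–Pollack line): `L(h)(𝟙) = 0`
  have hkum : ∃ t' : ℚ_[p], HasLocPKummerLog W p (layerZeroToTop W p K (I.proj 0 h)) t' :=
    Summit.BirchSwinnertonDyer.Rank1Residual.Additive.LocPKummer.hasLocPKummerLog_of_exists_log_ne_zero_of_mem_integralH1
      W p (hε W p ha ⟨h5, hord, hsurj⟩) (layerZeroToTop_mem_integralH1 W p K (I.proj_mem 0 h))
  have h0 : PowerSeries.constantCoeff (L h) = 0 := hLval h hkum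
  have h1 : ((1 : ℕ) : ℕ∞) ≤ (L h).order :=
    PowerSeries.nat_le_order (L h) 1 (fun i hi => by
      interval_cases i
      simpa only [PowerSeries.coeff_zero_eq_constantCoeff] using h0)
  rw [← hLord z₀ hz, hordeq, Nat.cast_add]
  exact add_le_add le_rfl h1

/-- **N2|door ∧ W₁ ⟹ Z₂ at an `a = 2` door cell** (the newform is read off the admissible class, witness
(A0) of `IsAdmissibleZetaClass`): `T² ∣ p^m z₀` would give `3 ≤ ρ_p ≤ 2`. The tenure-g2 sketch kernel
`derivedKatoDoor_of_ordCapTwo` over the FILED route decl `ColemanStepPosAt` (23147); N2|door («`a = 2 ⇒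
ord_T L_p(f, α_p) ≤ 2` at door primes for every newform», the `a = 2` door slice of `OrdCapAt 2` /
`PAdicOrderComparisonR2`) is displayed verbatim. CONDITIONAL (credits nothing).
[cite: Kato2004Asterisque, Thm. 16.6 (p. 271)] [cite: MazurTateTeitelbaum1986Invent, §II.10] -/
theorem noAdmissibleClassInTSq_of_ordCapTwoAtDoor_of_colemanStepPosAt
    (hN : ∀ (W : WeierstrassCurve ℚ) [W.IsElliptic] [W.IsGloballyMinimal] (p : ℕ) [Fact p.Prime]
      [ContinuousSMul ℤ_[p] (W.tateModule p)], W.analyticRank = 2 →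
      (5 ≤ p ∧ IsOrdinaryAt W p ∧ W.HasSurjectiveModNGaloisRep p) →
      ∀ {N : ℕ} [NeZero N] (f : CuspForm (CongruenceSubgroup.Gamma0 N) 2), IsNewformOf W f →
        (padicLFunction f ((unitRoot W p : ℤ_[p]) : ℚ_[p])).order ≤ ((2 : ℕ) : ℕ∞))
    (hW : ColemanStepPosAt) (W : WeierstrassCurve ℚ) [W.IsElliptic] [W.IsGloballyMinimal] (p : ℕ)
    [Fact p.Prime] [ContinuousSMul ℤ_[p] (W.tateModule p)] (ha : W.analyticRank = 2)
    (hdoor : 5 ≤ p ∧ IsOrdinaryAt W p ∧ W.HasSurjectiveModNGaloisRep p)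
    (K : ZpExtension ℚ p) (hK : K.IsCyclotomic) (γ : absoluteGaloisGroup ℚ) (I : IwasawaH1Data W p K γ)
    (z₀ : I.H) (hγ : K.IsTopGenerator γ) (hz : IsAdmissibleZetaClass W p K hK I z₀) :
    ¬ ∃ (h : I.H) (m : ℕ),
      ((p : IwasawaAlgebra p) ^ m) • z₀ = ((PowerSeries.X : IwasawaAlgebra p) ^ 2) • h := by
  intro hdiv
  have hz' := hz
  obtain ⟨-, N, hN0, f, hf, -⟩ := hz'
  have h3 : ((2 + 1 : ℕ) : ℕ∞) ≤ (padicLFunction f ((unitRoot W p : ℤ_[p]) : ℚ_[p])).order :=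
    hW W p ha hdoor K hK γ I z₀ hγ hz f hf 2 hdiv
  have h32 : ((2 + 1 : ℕ) : ℕ∞) ≤ ((2 : ℕ) : ℕ∞) := h3.trans (hN W p ha hdoor f hf)
  exact absurd (by exact_mod_cast h32 : (2 + 1 : ℕ) ≤ 2) (by omega)

/-- **The PARENT crux `DerivedKatoDoor` from N2|door ∧ W₁** (`ColemanStepPosAt`, 23147): the tenure-g2
kernel `derivedKatoDoor_of_ordCapTwo` over the filed decls. CONDITIONAL (N2|door is OPEN, W₁ is an open
rider; credits nothing). [cite: Kato2004Asterisque, Thm. 16.6 (p. 271)] -/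
theorem derivedKatoDoor_of_ordCapTwoAtDoor_of_colemanStepPosAt
    (hN : ∀ (W : WeierstrassCurve ℚ) [W.IsElliptic] [W.IsGloballyMinimal] (p : ℕ) [Fact p.Prime]
      [ContinuousSMul ℤ_[p] (W.tateModule p)], W.analyticRank = 2 →
      (5 ≤ p ∧ IsOrdinaryAt W p ∧ W.HasSurjectiveModNGaloisRep p) →
      ∀ {N : ℕ} [NeZero N] (f : CuspForm (CongruenceSubgroup.Gamma0 N) 2), IsNewformOf W f →
        (padicLFunction f ((unitRoot W p : ℤ_[p]) : ℚ_[p])).order ≤ ((2 : ℕ) : ℕ∞))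
    (hW : ColemanStepPosAt) : DerivedKatoDoor := by
  intro W _ _ p _ _ ha hdoor K hK γ I z₀ hγ hz
  exact noAdmissibleClassInTSq_of_ordCapTwoAtDoor_of_colemanStepPosAt hN hW W p ha hdoor K hK γ I z₀ hγ hz

/-- **The OUTPUT composition with every input displayed** (line `output` of the LEAD's
`Cruxes/FineLengthLeOneOfAnalyticRankTwo/Lines/output.lean`, its four stubs as hypotheses): X′ =
`FineLengthLeOneOfAnalyticRankTwo` from N2|door (OPEN), the rider ε (`CrisAtDoorPrimes`, 23148), the route
items `AdmissibleZetaClassExists` (23029) and `KatoMainConjecturePrimeTOfDoor` (23260), and the named facts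
`exists_colemanMap_admissibleZeta`, `thm12_4`: ε ⟹ W₁ (§2) and N2|door ∧ W₁ ⟹ Z₂, then §1. CONDITIONAL
(credits nothing); recorded to certify that the Coleman output line's open content is N2|door ∧ ε.
[cite: Kato2004Asterisque, Thm. 16.6 (p. 271), Thm. 12.4 (3) (p. 221), Thm. 12.5 (4) (p. 222)] -/
theorem fineLengthLeOne_of_ordCapTwoAtDoor_of_crisAtDoorPrimes_of_facts
    (hN : ∀ (W : WeierstrassCurve ℚ) [W.IsElliptic] [W.IsGloballyMinimal] (p : ℕ) [Fact p.Prime]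
      [ContinuousSMul ℤ_[p] (W.tateModule p)], W.analyticRank = 2 →
      (5 ≤ p ∧ IsOrdinaryAt W p ∧ W.HasSurjectiveModNGaloisRep p) →
      ∀ {N : ℕ} [NeZero N] (f : CuspForm (CongruenceSubgroup.Gamma0 N) 2), IsNewformOf W f →
        (padicLFunction f ((unitRoot W p : ℤ_[p]) : ℚ_[p])).order ≤ ((2 : ℕ) : ℕ∞))
    (hε : CrisAtDoorPrimes) (hAdm : AdmissibleZetaClassExists) (hC : exists_colemanMap_admissibleZeta)
    (h124 : thm12_4) (hmc : KatoMainConjecturePrimeTOfDoor) : FineLengthLeOneOfAnalyticRankTwo := by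
  intro W _ _ p _ _ ha hdoor K hK γ hγ
  exact fineLength_le_one_of_noAdmissibleClassInTSq h124 hmc W p hdoor (hAdm W p hdoor)
    (noAdmissibleClassInTSq_of_ordCapTwoAtDoor_of_colemanStepPosAt hN
      (colemanStepPosAt_of_crisAtDoorPrimes_of_colemanMap hC hε) W p ha hdoor) hK hγ

/-! ## §3 POSITION of the Coleman output stub N2|door relative to the route decls -/

/-- **Z₂ ∧ C₂' ∧ E ⟹ N2|door** (the tenure-g2 sketch kernel `ordCapTwoAtDoorPrimes_of_doors` over the filed
route decls `DerivedKatoDoor` (23024), `ColemanStepDoor` (aside 23145), `AdmissibleZetaClassExists` (23029)):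
given an admissible class, D-K₂ says `T² ∤ z₀` rationally and C₂' at `k = 1` turns that into `ρ_p ≤ 2`.
With `derivedKatoDoor_of_ordCapTwoAtDoor_of_colemanStepPosAt` and
`colemanStepDoor_of_ordCapTwoAtDoor_of_zetaDepthPosAt`: N2|door ≡ Z₂ ∧ C₂' modulo the riders
{23029, 23146, 23147}. CONDITIONAL (credits nothing). [cite: Kato2004Asterisque, Thm. 16.6 (p. 271)] -/
theorem ordCapTwoAtDoor_of_derivedKatoDoor_of_colemanStepDoor (hZ : DerivedKatoDoor) (hC : ColemanStepDoor)
    (hE : AdmissibleZetaClassExists) :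
    ∀ (W : WeierstrassCurve ℚ) [W.IsElliptic] [W.IsGloballyMinimal] (p : ℕ) [Fact p.Prime]
      [ContinuousSMul ℤ_[p] (W.tateModule p)], W.analyticRank = 2 →
      (5 ≤ p ∧ IsOrdinaryAt W p ∧ W.HasSurjectiveModNGaloisRep p) →
      ∀ {N : ℕ} [NeZero N] (f : CuspForm (CongruenceSubgroup.Gamma0 N) 2), IsNewformOf W f →
        (padicLFunction f ((unitRoot W p : ℤ_[p]) : ℚ_[p])).order ≤ ((2 : ℕ) : ℕ∞) := by
  intro W _ _ p _ _ ha hdoor N _ f hf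
  obtain ⟨K, hK, γ, I, z₀, hγ, hz⟩ := hE W p hdoor
  have hv := hZ W p ha hdoor K hK γ I z₀ hγ hz
  exact hC W p ha hdoor K hK γ I z₀ hγ hz f hf 1 hv

/-- **N2|door ∧ V₁ ⟹ C₂'** (the tenure-g2 kernel `colemanStepDoor_of_ordCapTwo` over the filed decls
`ZetaDepthPosAt` (23146) and `ColemanStepDoor` (23145)): at `k = 0` the rider V₁ makes the hypothesis
`T ∤ z₀` false; at `k ≥ 1`, `ρ_p ≤ 2 ≤ k + 1`. CONDITIONAL (credits nothing).
[cite: Kato2004Asterisque, Thm. 12.5 (1) (p. 221), Thm. 16.6 (p. 271)] -/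
theorem colemanStepDoor_of_ordCapTwoAtDoor_of_zetaDepthPosAt
    (hN : ∀ (W : WeierstrassCurve ℚ) [W.IsElliptic] [W.IsGloballyMinimal] (p : ℕ) [Fact p.Prime]
      [ContinuousSMul ℤ_[p] (W.tateModule p)], W.analyticRank = 2 →
      (5 ≤ p ∧ IsOrdinaryAt W p ∧ W.HasSurjectiveModNGaloisRep p) →
      ∀ {N : ℕ} [NeZero N] (f : CuspForm (CongruenceSubgroup.Gamma0 N) 2), IsNewformOf W f →
        (padicLFunction f ((unitRoot W p : ℤ_[p]) : ℚ_[p])).order ≤ ((2 : ℕ) : ℕ∞))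
    (hV : ZetaDepthPosAt) : ColemanStepDoor := by
  intro W _ _ p _ _ ha hdoor K hK γ I z₀ hγ hz N _ f hf k hk
  cases k with
  | zero => exact absurd (hV W p ha hdoor K hK γ I z₀ hγ hz) (by simpa using hk)
  | succ k =>
    refine (hN W p ha hdoor f hf).trans ?_
    exact_mod_cast (by omega : 2 ≤ k + 1 + 1)


end Summit.BirchSwinnertonDyer.BirchSwinnertonDyer.Theorems.DerivedKatoValuationDoor

end
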